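import Summits.Ventures.PercRepro.GenQTracePairs

/-!
# PercRepro — the trace-pair row (R1), part 2: the per-basis bound and the row (night-4 gen 4)
`card_planePairs_le : #planePairs(B₀) ≤ (q − 2)·k₃(B₀) + 2·k₄(B₀)` — pairs of two `2`-traces share a basis point `b` and are
counted by `Σ_b C(|D_b|, 2)` with `|D_b| ≤ q − 1`; a pair with a `3`-trace member `y` has its other member in `K_{T_y} ∖ y`
(`≤ 2` choices) — and the row **(R1)** `card_Pc_sub_two_plane_le : 8·#Pc (d−2) (q−3) ≤ 3(q−2)·#Pc (d−1) (q−2) + 8·#Pc (d−1) (q−3)`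
from `eight_le_nb`, `sum_nb_pair_le`, the per-basis bound and `sum_kc_eq`.  Imports `GenQTracePairs` (part 1).
-/
namespace PercRepro.Night4

open Finset ThmH SixFour GenQ PerFlat Star

variable {α : Type*} [DecidableEq α] {M : Matroid α} [M.Finite]

omit [M.Finite] in
/-- A point outside `B₀` other than `y` is not in `C_y`. -/
theorem notMem_fc_of_ne {B₀ : Finset α} {x y : α} (hxy : x ≠ y) (hxB : x ∉ B₀) : x ∉ fc M y B₀ := fun h => by
  have := fc_subset_insert y B₀ h
  rw [Finset.mem_insert] at this
  rcases this with h' | h'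
  · exact hxy h'
  · exact hxB h'

omit [M.Finite] in
/-- In a plane-type pair with `|C_y| = 4`: `C_x ∖ x ⊆ C_y ∖ y` (the union is `insert x C_y`). -/
theorem fc_erase_subset_of_four {B₀ : Finset α} {x y : α} (hxy : x ≠ y) (hxB : x ∉ B₀) (hyB : y ∉ B₀)
    (h5 : (fc M x B₀ ∪ fc M y B₀).card = 5) (h4 : (fc M y B₀).card = 4) :
    (fc M x B₀).erase x ⊆ (fc M y B₀).erase y := by
  have hxy' : x ∉ fc M y B₀ := notMem_fc_of_ne hxy hxB
  have hyx : y ∉ fc M x B₀ := notMem_fc_of_ne hxy.symm hyB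
  have heq : fc M x B₀ ∪ fc M y B₀ = insert x (fc M y B₀) := by
    symm
    apply Finset.eq_of_subset_of_card_le
    · exact Finset.insert_subset (Finset.mem_union_left _ (mem_fc_self x B₀)) Finset.subset_union_right
    · exact le_of_eq (by rw [h5, Finset.card_insert_of_notMem hxy', h4])
  intro z hz
  rw [Finset.mem_erase] at hz
  rw [Finset.mem_erase]
  refine ⟨fun h => hyx (h ▸ hz.2), ?_⟩
  have : z ∈ fc M x B₀ ∪ fc M y B₀ := Finset.mem_union_left _ hz.2
  rw [heq, Finset.mem_insert] at this
  exact this.resolve_left hz.1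

/-- **Per basis: `#planePairs(B₀) ≤ (q − 2)·k₃(B₀) + 2·k₄(B₀)`.** Pairs of two `2`-traces share a basis point `b`
and are counted by `Σ_b C(|D_b|, 2)` with `|D_b| ≤ q − 1`; a pair with a `3`-trace member `y` has its other
member in `K_{T_y} ∖ y`, of size `≤ 2`. -/
theorem card_planePairs_le (hs : Simple M) (hline : ∀ L ∈ flatsQ M 2, L.card ≤ 3)
    (hplane : ∀ P ∈ flatsQ M 3, P.card ≤ 6) {G B₀ : Finset α} {q : ℕ} (hG : G ⊆ gr M)
    (hrG : M.eRk (G : Set α) = (q : ℕ∞)) (hq : 3 ≤ q) (hB : B₀ ∈ basesOf M G q) :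
    (planePairs M G B₀ q).card ≤ (q - 2) * kc M G B₀ 3 + 2 * kc M G B₀ 4 := by
  -- the shape of a pair
  have hshape : ∀ P ∈ planePairs M G B₀ q, ∃ x y, x ≠ y ∧ P = {x, y} ∧ x ∈ G ∧ x ∉ B₀ ∧ y ∈ G ∧ y ∉ B₀ ∧
      (fc M x B₀ ∪ fc M y B₀).card = 5 ∧ 3 ≤ (fc M x B₀).card ∧ (fc M x B₀).card ≤ 4 ∧
      3 ≤ (fc M y B₀).card ∧ (fc M y B₀).card ≤ 4 := by
    intro P hP
    unfold planePairs at hP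
    rw [Finset.mem_filter, Finset.mem_powersetCard] at hP
    obtain ⟨⟨hPG, hP2⟩, hm⟩ := hP
    obtain ⟨x, y, hxy, rfl⟩ := Finset.card_eq_two.1 hP2
    have hx := Finset.mem_sdiff.1 (hPG (Finset.mem_insert_self x {y}))
    have hy := Finset.mem_sdiff.1 (hPG (Finset.mem_insert_of_mem (Finset.mem_singleton_self y)))
    have hm' : mTr M (insert x (insert y B₀)) = q - 3 := by
      rw [← hm]
      congr 1
      ext z
      simp only [Finset.mem_union, Finset.mem_insert, Finset.mem_singleton]
      tauto
    obtain ⟨h5, h3x, h4x, h3y, h4y⟩ :=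
      fc_union_card_of_planePair hs hline hG hrG hq hB hx.1 hx.2 hy.1 hy.2 hxy hm'
    exact ⟨x, y, hxy, rfl, hx.1, hx.2, hy.1, hy.2, h5, h3x, h4x, h3y, h4y⟩
  -- a pair with a `3`-trace member `y` (listed second) lies in the image of `Σ_y (K_{T_y} ∖ y)`
  have hkey : ∀ x y : α, x ≠ y → x ∈ G → x ∉ B₀ → y ∈ G → y ∉ B₀ → (fc M x B₀ ∪ fc M y B₀).card = 5 →
      (fc M y B₀).card = 4 →
      ({x, y} : Finset α) ∈ (((G \ B₀).filter (fun y => (fc M y B₀).card = 4)).sigma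
        (fun y => (KT M G B₀ ((fc M y B₀).erase y)).erase y)).image
          (fun p : Σ _ : α, α => ({p.2, p.1} : Finset α)) := by
    intro x y hxy hxG hxB hyG hyB h5 h4
    rw [Finset.mem_image]
    refine ⟨⟨y, x⟩, ?_, rfl⟩
    rw [Finset.mem_sigma, Finset.mem_filter, Finset.mem_sdiff, Finset.mem_erase, mem_KT, Finset.mem_sdiff]
    refine ⟨⟨⟨hyG, hyB⟩, h4⟩, hxy, ⟨hxG, hxB⟩, ?_⟩
    rw [mem_closure_iff_fc_erase_subset hG hrG hB (fc_erase_subset y) hxG hxB]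
    exact fc_erase_subset_of_four hxy hxB hyB h5 h4
  have hsplit := (Finset.card_filter_add_card_filter_not
    (s := planePairs M G B₀ q) (fun P => ∀ x ∈ P, (fc M x B₀).card = 3)).symm
  -- (i) pairs of two `2`-traces
  have hA : 2 * ((planePairs M G B₀ q).filter (fun P => ∀ x ∈ P, (fc M x B₀).card = 3)).card ≤
      2 * ((q - 2) * kc M G B₀ 3) := by
    have hsub : (planePairs M G B₀ q).filter (fun P => ∀ x ∈ P, (fc M x B₀).card = 3) ⊆
        (B₀.sigma (fun b => (Db M G B₀ b).powersetCard 2)).image Sigma.snd := by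
      intro P hP
      rw [Finset.mem_filter] at hP
      obtain ⟨hP, h3⟩ := hP
      obtain ⟨x, y, hxy, rfl, hxG, hxB, hyG, hyB, h5, -, -, -, -⟩ := hshape _ hP
      have h3x := h3 x (Finset.mem_insert_self x {y})
      have h3y := h3 y (Finset.mem_insert_of_mem (Finset.mem_singleton_self y))
      have hxy' : x ∉ fc M y B₀ := notMem_fc_of_ne hxy hxB
      have hyx : y ∉ fc M x B₀ := notMem_fc_of_ne hxy.symm hyB
      -- a common basis point: `|C_x ∖ x| + |C_y ∖ y| = 4 > 3 = |(C_x ∪ C_y) ∖ {x, y}|`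
      have hcap : (((fc M x B₀).erase x) ∩ ((fc M y B₀).erase y)).Nonempty := by
        rw [Finset.nonempty_iff_ne_empty]
        intro hemp
        have hdisj : Disjoint ((fc M x B₀).erase x) ((fc M y B₀).erase y) :=
          Finset.disjoint_iff_inter_eq_empty.2 hemp
        have hsub' : (fc M x B₀).erase x ∪ (fc M y B₀).erase y ⊆ ((fc M x B₀ ∪ fc M y B₀).erase x).erase y := by
          intro z hz
          rw [Finset.mem_union, Finset.mem_erase, Finset.mem_erase] at hz
          rw [Finset.mem_erase, Finset.mem_erase, Finset.mem_union]
          rcases hz with ⟨hzx, hz⟩ | ⟨hzy, hz⟩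
          · exact ⟨fun h => hyx (h ▸ hz), hzx, Or.inl hz⟩
          · exact ⟨hzy, fun h => hxy' (h ▸ hz), Or.inr hz⟩
        have hc := Finset.card_le_card hsub'
        rw [Finset.card_union_of_disjoint hdisj, Finset.card_erase_of_mem (mem_fc_self x B₀),
          Finset.card_erase_of_mem (mem_fc_self y B₀), h3x, h3y,
          Finset.card_erase_of_mem (Finset.mem_erase.2 ⟨hxy.symm, Finset.mem_union_right _ (mem_fc_self y B₀)⟩),
          Finset.card_erase_of_mem (Finset.mem_union_left _ (mem_fc_self x B₀)), h5] at hc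
        omega
      obtain ⟨b, hb⟩ := hcap
      rw [Finset.mem_inter, Finset.mem_erase, Finset.mem_erase] at hb
      have hbB : b ∈ B₀ := fc_erase_subset x (Finset.mem_erase.2 hb.1)
      rw [Finset.mem_image]
      refine ⟨⟨b, {x, y}⟩, ?_, rfl⟩
      rw [Finset.mem_sigma, Finset.mem_powersetCard]
      refine ⟨hbB, ?_, Finset.card_pair hxy⟩
      intro z hz
      rw [Finset.mem_insert, Finset.mem_singleton] at hz
      unfold Db
      rw [Finset.mem_filter, Finset.mem_sdiff]
      rcases hz with rfl | rfl
      · exact ⟨⟨hxG, hxB⟩, h3x, hb.1.2⟩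
      · exact ⟨⟨hyG, hyB⟩, h3y, hb.2.2⟩
    calc 2 * ((planePairs M G B₀ q).filter (fun P => ∀ x ∈ P, (fc M x B₀).card = 3)).card
        ≤ 2 * (B₀.sigma (fun b => (Db M G B₀ b).powersetCard 2)).card :=
          Nat.mul_le_mul_left 2 ((Finset.card_le_card hsub).trans Finset.card_image_le)
      _ = ∑ b ∈ B₀, 2 * ((Db M G B₀ b).card.choose 2) := by
          rw [Finset.card_sigma, Finset.mul_sum]
          apply Finset.sum_congr rfl
          intro b _
          rw [Finset.card_powersetCard]
      _ ≤ ∑ b ∈ B₀, (q - 2) * (Db M G B₀ b).card := by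
          apply Finset.sum_le_sum
          intro b hb
          have hn := card_Db_le hs hline hG hrG hq hB hb
          rw [Nat.choose_two_right]
          calc 2 * ((Db M G B₀ b).card * ((Db M G B₀ b).card - 1) / 2)
              ≤ (Db M G B₀ b).card * ((Db M G B₀ b).card - 1) := Nat.mul_div_le _ 2
            _ ≤ (Db M G B₀ b).card * (q - 2) := Nat.mul_le_mul_left _ (by omega)
            _ = (q - 2) * (Db M G B₀ b).card := Nat.mul_comm _ _
      _ = 2 * ((q - 2) * kc M G B₀ 3) := by rw [← Finset.mul_sum, sum_card_Db_eq, Nat.mul_left_comm]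
  -- (ii) pairs with a `3`-trace member
  have hB' : ((planePairs M G B₀ q).filter (fun P => ¬ ∀ x ∈ P, (fc M x B₀).card = 3)).card ≤ 2 * kc M G B₀ 4 := by
    have hsub : (planePairs M G B₀ q).filter (fun P => ¬ ∀ x ∈ P, (fc M x B₀).card = 3) ⊆
        (((G \ B₀).filter (fun y => (fc M y B₀).card = 4)).sigma
          (fun y => (KT M G B₀ ((fc M y B₀).erase y)).erase y)).image
            (fun p : Σ _ : α, α => ({p.2, p.1} : Finset α)) := by
      intro P hP
      rw [Finset.mem_filter] at hP
      obtain ⟨hP, h3⟩ := hP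
      obtain ⟨x, y, hxy, rfl, hxG, hxB, hyG, hyB, h5, h3x, h4x, h3y, h4y⟩ := hshape _ hP
      by_cases h4 : (fc M y B₀).card = 4
      · exact hkey x y hxy hxG hxB hyG hyB h5 h4
      · have h4' : (fc M x B₀).card = 4 := by
          by_contra h4'
          apply h3
          intro z hz
          rw [Finset.mem_insert, Finset.mem_singleton] at hz
          rcases hz with rfl | rfl <;> omega
        rw [Finset.pair_comm]
        exact hkey y x hxy.symm hyG hyB hxG hxB (by rw [Finset.union_comm]; exact h5) h4'
    calc ((planePairs M G B₀ q).filter (fun P => ¬ ∀ x ∈ P, (fc M x B₀).card = 3)).card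
        ≤ (((G \ B₀).filter (fun y => (fc M y B₀).card = 4)).sigma
            (fun y => (KT M G B₀ ((fc M y B₀).erase y)).erase y)).card :=
          (Finset.card_le_card hsub).trans Finset.card_image_le
      _ = ∑ y ∈ (G \ B₀).filter (fun y => (fc M y B₀).card = 4),
            ((KT M G B₀ ((fc M y B₀).erase y)).erase y).card := Finset.card_sigma _ _
      _ ≤ ∑ y ∈ (G \ B₀).filter (fun y => (fc M y B₀).card = 4), 2 := by
          apply Finset.sum_le_sum
          intro y hy
          rw [Finset.mem_filter, Finset.mem_sdiff] at hy
          obtain ⟨⟨hyG, hyB⟩, h4⟩ := hy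
          have hT : (fc M y B₀).erase y ∈ B₀.powersetCard 3 := by
            rw [Finset.mem_powersetCard, Finset.card_erase_of_mem (mem_fc_self y B₀), h4]
            exact ⟨fc_erase_subset y, rfl⟩
          have h3K := card_KT_le_three hplane hG hB hT
          have hyK : y ∈ KT M G B₀ ((fc M y B₀).erase y) := by
            rw [mem_KT, Finset.mem_sdiff,
              mem_closure_iff_fc_erase_subset hG hrG hB (fc_erase_subset y) hyG hyB]
            exact ⟨⟨hyG, hyB⟩, Finset.Subset.refl _⟩
          have := Finset.card_erase_lt_of_mem hyK
          omega
      _ = 2 * kc M G B₀ 4 := by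
          unfold kc
          rw [Finset.sum_const, smul_eq_mul, mul_comm]
  rw [hsplit]
  exact Nat.add_le_add (Nat.le_of_mul_le_mul_left hA (by norm_num)) hB'

/-- **(R1) `8·#Pc (d−2) (q−3) ≤ 3(q−2)·#Pc (d−1) (q−2) + 8·#Pc (d−1) (q−3)`**: every plane-type level-`(d−2)`
set has `≥ 8` bases; the pairs `(S, B₀)` inject into `Σ_{B₀} planePairs(B₀)`; per basis
`#planePairs ≤ (q−2)k₃ + 2k₄`; and `Σ k₃ = 3·#Pc (d−1) (q−2)`, `Σ k₄ = 4·#Pc (d−1) (q−3)`. -/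
theorem card_Pc_sub_two_plane_le (hs : Simple M) (hline : ∀ L ∈ flatsQ M 2, L.card ≤ 3)
    (hplane : ∀ P ∈ flatsQ M 3, P.card ≤ 6) {G : Finset α} {q d : ℕ} (hG : G ⊆ gr M)
    (hrG : M.eRk (G : Set α) = (q : ℕ∞)) (hq : 3 ≤ q) (hcard : G.card = q + d) (hd : 2 ≤ d) :
    8 * (Pc M G q (d - 2) (q - 3)).card ≤
      3 * (q - 2) * (Pc M G q (d - 1) (q - 2)).card + 8 * (Pc M G q (d - 1) (q - 3)).card := by
  have h1 : 8 * (Pc M G q (d - 2) (q - 3)).card ≤ ∑ S ∈ Pc M G q (d - 2) (q - 3), nb M G S q := by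
    rw [Finset.card_eq_sum_ones, Finset.mul_sum]
    apply Finset.sum_le_sum
    intro S hS
    rw [mul_one]
    exact eight_le_nb hs hline hG hq hcard hS hd
  have h2 := sum_nb_pair_le (M := M) hcard hd
  have h3 : ∑ B₀ ∈ basesOf M G q, (planePairs M G B₀ q).card ≤
      ∑ B₀ ∈ basesOf M G q, ((q - 2) * kc M G B₀ 3 + 2 * kc M G B₀ 4) :=
    Finset.sum_le_sum (fun B₀ hB => card_planePairs_le hs hline hplane hG hrG hq hB)
  rw [Finset.sum_add_distrib, ← Finset.mul_sum, ← Finset.mul_sum,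
    sum_kc_eq (c := 3) hG hrG hcard (by omega) (by omega),
    sum_kc_eq (c := 4) hG hrG hcard (by omega) (by omega)] at h3
  have e1 : q + 1 - 3 = q - 2 := by omega
  have e2 : q + 1 - 4 = q - 3 := by omega
  rw [e1, e2] at h3
  calc 8 * (Pc M G q (d - 2) (q - 3)).card ≤ ∑ S ∈ Pc M G q (d - 2) (q - 3), nb M G S q := h1
    _ ≤ ∑ B₀ ∈ basesOf M G q, (planePairs M G B₀ q).card := h2
    _ ≤ (q - 2) * (3 * (Pc M G q (d - 1) (q - 2)).card) + 2 * (4 * (Pc M G q (d - 1) (q - 3)).card) := h3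
    _ = 3 * (q - 2) * (Pc M G q (d - 1) (q - 2)).card + 8 * (Pc M G q (d - 1) (q - 3)).card := by ring

end PercRepro.Night4
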